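import Summits.HodgeConjecture.HodgeConjecture.Theorems.R90S6TorusFixedSpecialCountTwoCongruent   -- ★ rung 1′ `natCard_fixedBy_special_eq_one_add_mul_of_residually_two_congruent` (frame currency)
import Summits.HodgeConjecture.HodgeConjecture.Theorems.R90S6ResidualTwoCongruentEigenframe     -- ★ T1 `exists_eigenframe_of_charpoly_two_congruent` (over 𝓀)
import Summits.HodgeConjecture.HodgeConjecture.Theorems.R90S6ResidualUnitaryReduction          -- ★ p07 dictionary `exists_residual_unitary`, `residue_B₀_eq`, `B₀_coe_mem_integer`
import HarnessLib

/-!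
# R90 · S6 — LINE S1, REGIME R-II TRANSPORT RUNG T, FILE T2: `a₁ = 1 + q·m` FROM THE INTRINSIC LETTERS `χ_γ ≡ (X − c₁)²(X − c₂)`, `|c₁ − c₂| = 1`
# (`Theorems/R90S6TorusFixedSpecialCountTwoCongruentIntrinsic.lean`)

Cell `hodgecm-mathlib`, crux H413 (`stmt-HodgeConjecture-24833`), route of record `HCCMUnconditional`; programme R90-TF, section S6 (base `R90-C14`), seat R90-C14-p05 (g0);
S6 dealer R90-C14-plan (g2) RULING G1-R3 01:30:33Z «R-II TRANSPORT RUNG T is ON PATH» and heads «=» 01:34:00Z (including the norm-one letters `hu₁ hu₂`).  Helper lane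
`--supports stmt-HodgeConjecture-24833 --as helper`; THEOREMS ONLY (no definition, no instance, no notation, no named fact, no `sorry`).

THE MATHEMATICS [Kottwitz1988, §2; Tits1979, §3.5; Serre1980Trees, I.6 and II.1.1; Rogawski1990, §4.9].  §1 `exists_frame_of_charpoly_two_congruent` DISCHARGES the frame
hypothesis `hframe` of ★ rung 1′ for ONE `k ∈ K₀` with `χ_k ≡ (X − c₁)²(X − c₂)` coefficientwise mod `𝔪`, `|c₁| = |c₁ − c₂| = 1`, `σ(cᵢ)cᵢ ≡ 1`: reduce `k` to
`k̄ ∈ U₃(𝓀)` (★ `exists_residual_unitary`), read `χ_{k̄} = (X − c̄₁)²(X − c̄₂)` off the congruence (`Matrix.charpoly_map`), take the residual eigenframe `P̄` of ★ T1, LIFT it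
entrywise to an integral `P` with `|det P| = 1` (so `P ∈ GL₃(𝒪)`, ★ `mem_glInt_of_isIntegralMatrix` ∕ `mem_glInt_iff_forall_v_le_one`), and transport every residual identity
(`Ā = P̄⁻¹k̄P̄` entries, `B̄₀` of the columns — ★ `residue_B₀_eq`) to the valuation inequalities of `hframe`.  §2 THE HEAD `natCard_fixedBy_special_eq_one_add_mul_of_charpoly_two_congruent`
= ★ rung 1′ with `hframe` discharged at every fixed hyperspecial `x` (`χ_{k_x} = χ_γ` by conjugation): **`a₁ = 1 + q·m`**, `m = #{x ∈ Fix_γ(U⧸K₀) : (k_x − c₁)(k_x − c₂) ≡ 0}`,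
from the INTRINSIC letters `(hc₁) (hsep) (hu₁) (hu₂) (hχ)` only.
HONEST LABEL: a composition (★ rung 1′ ∘ ★ T1 ∘ ★ p07 dictionary), unconditional in its letters; count-neutral until the closed form of `m` and the E1.3.5.2 assembly consume it;
proves no printed statement.  HC_CM is proved only modulo the 7 printed citations (2 remaining named inputs: hLiu418 = stmt-HodgeConjecture-24832, h413 = stmt-HodgeConjecture-24833)
until rung 0 closes.
-/

set_option autoImplicit false
-- the mandated namespace repeats the single-problem summit's segment (`HodgeConjecture.HodgeConjecture`)
set_option linter.dupNamespace false

noncomputable section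

open MulAction Polynomial
open Literature.NumberTheory.Automorphic Literature.NumberTheory.Automorphic.HermitianLattice Literature.NumberTheory.Automorphic.UnitaryGroup
open Literature.NumberTheory.Automorphic.UnitaryLatticeTree Literature.FieldTheory.FiniteFields
open scoped Matrix MatrixGroups WithZero Valued

namespace Summit.HodgeConjecture.HodgeConjecture.R90.S6

variable {K : Type*} [Field K] [Valued K ℤᵐ⁰]

/-- **§1 THE INTEGRAL FRAME OF A TWO-CONGRUENT `k ∈ K₀`** (discharges `hframe` of ★ rung 1′ for one `k`).  For `k ∈ K₀` with `χ_k ≡ (X − c₁)²(X − c₂)` coefficientwise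
mod `𝔪`, `|c₁| = |c₁ − c₂| = 1`, `σ(cᵢ)cᵢ ≡ 1` (residue field of order `q²`, `σ` reducing to the `q`-Frobenius `σk`): there is `P ∈ GL₃(K)` with `P, P⁻¹` integral such that
`A = P⁻¹kP` has `|A₀₀ − c₁|, |A₁₁ − c₁|, |A₂₂ − c₂| < 1`, all off-diagonal entries other than `A₁₀` in `𝔪`, `|B₀(Pe₂,Pe₂)| = 1`, `|B₀(Pe₁,Pe₁)| < 1`, and, if `|A₁₀| < 1`,
`|B₀(Pe₀,Pe₀)| < 1` and `|B₀(Pe₀,Pe₁)| = 1` (the GL₃(𝒪)-lift of the residual eigenframe ★ T1). [cite: Tits1979, §3.5] [cite: Serre1980Trees, II.1.1] -/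
theorem exists_frame_of_charpoly_two_congruent [ValuativeRel K] [(Valued.v : Valuation K ℤᵐ⁰).Compatible]
    {σ : K →+* K} (hσO : ∀ x : 𝒪[K], σ x ∈ 𝒪[K]) (σk : 𝓀[K] →+* 𝓀[K])
    (hσk : ∀ x : 𝒪[K], IsLocalRing.residue 𝒪[K] ⟨σ x, hσO x⟩ = σk (IsLocalRing.residue 𝒪[K] x))
    [Fintype 𝓀[K]] {q : ℕ} (hq : Fintype.card 𝓀[K] = q ^ 2) (hfrob : ∀ y, σk y = y ^ q)
    (k : ↥(unitaryGroupOfForm σ ((StdForm.antidiagonal 3).over K))) (hk : k ∈ unitaryInt σ ((StdForm.antidiagonal 3).over K))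
    {c₁ c₂ : K} (hc₁ : Valued.v c₁ = 1) (hsep : Valued.v (c₁ - c₂) = 1) (hu₁ : Valued.v (σ c₁ * c₁ - 1) < 1) (hu₂ : Valued.v (σ c₂ * c₂ - 1) < 1)
    (hχ : ∀ i, Valued.v ((((k : GL (Fin 3) K) : Matrix (Fin 3) (Fin 3) K).charpoly - (X - C c₁) ^ 2 * (X - C c₂)).coeff i) < 1) :
    ∃ P : GL (Fin 3) K, (∀ i j, Valued.v ((P : Matrix (Fin 3) (Fin 3) K) i j) ≤ 1) ∧ (∀ i j, Valued.v (((P⁻¹ : GL (Fin 3) K) : Matrix (Fin 3) (Fin 3) K) i j) ≤ 1) ∧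
      Valued.v ((((P⁻¹ : GL (Fin 3) K) : Matrix (Fin 3) (Fin 3) K) * ((k : GL (Fin 3) K) : Matrix (Fin 3) (Fin 3) K) * (P : Matrix (Fin 3) (Fin 3) K)) 0 0 - c₁) < 1 ∧
      Valued.v ((((P⁻¹ : GL (Fin 3) K) : Matrix (Fin 3) (Fin 3) K) * ((k : GL (Fin 3) K) : Matrix (Fin 3) (Fin 3) K) * (P : Matrix (Fin 3) (Fin 3) K)) 1 1 - c₁) < 1 ∧
      Valued.v ((((P⁻¹ : GL (Fin 3) K) : Matrix (Fin 3) (Fin 3) K) * ((k : GL (Fin 3) K) : Matrix (Fin 3) (Fin 3) K) * (P : Matrix (Fin 3) (Fin 3) K)) 2 2 - c₂) < 1 ∧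
      (∀ i j : Fin 3, i ≠ j → (i, j) ≠ ((1 : Fin 3), (0 : Fin 3)) →
        Valued.v ((((P⁻¹ : GL (Fin 3) K) : Matrix (Fin 3) (Fin 3) K) * ((k : GL (Fin 3) K) : Matrix (Fin 3) (Fin 3) K) * (P : Matrix (Fin 3) (Fin 3) K)) i j) < 1) ∧
      Valued.v (B₀ σ 3 ((P : Matrix (Fin 3) (Fin 3) K).mulVec (Pi.single 2 1)) ((P : Matrix (Fin 3) (Fin 3) K).mulVec (Pi.single 2 1))) = 1 ∧
      Valued.v (B₀ σ 3 ((P : Matrix (Fin 3) (Fin 3) K).mulVec (Pi.single 1 1)) ((P : Matrix (Fin 3) (Fin 3) K).mulVec (Pi.single 1 1))) < 1 ∧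
      (Valued.v ((((P⁻¹ : GL (Fin 3) K) : Matrix (Fin 3) (Fin 3) K) * ((k : GL (Fin 3) K) : Matrix (Fin 3) (Fin 3) K) * (P : Matrix (Fin 3) (Fin 3) K)) 1 0) < 1 →
        Valued.v (B₀ σ 3 ((P : Matrix (Fin 3) (Fin 3) K).mulVec (Pi.single 0 1)) ((P : Matrix (Fin 3) (Fin 3) K).mulVec (Pi.single 0 1))) < 1 ∧
        Valued.v (B₀ σ 3 ((P : Matrix (Fin 3) (Fin 3) K).mulVec (Pi.single 0 1)) ((P : Matrix (Fin 3) (Fin 3) K).mulVec (Pi.single 1 1))) = 1) := by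
  classical
  have hkint := (mem_unitaryInt_iff.1 hk).1
  -- residual data
  obtain ⟨kb, hkbU, hkbe, -⟩ := exists_residual_unitary hσO σk hσk hk
  set kM : Matrix (Fin 3) (Fin 3) K := ((k : GL (Fin 3) K) : Matrix (Fin 3) (Fin 3) K) with hkM
  set kO : Matrix (Fin 3) (Fin 3) 𝒪[K] := Matrix.of fun i j => (⟨kM i j, hkint i j⟩ : 𝒪[K]) with hkO
  have hkOK : kO.map (𝒪[K].subtype) = kM := by ext i j; rfl
  have hkOk : kO.map (IsLocalRing.residue 𝒪[K]) = (kb : Matrix (Fin 3) (Fin 3) 𝓀[K]) := by ext i j; rw [Matrix.map_apply, hkbe]; rfl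
  -- the scalars and their residues
  have hc₂ : Valued.v c₂ ≤ 1 := by
    have e : c₂ = c₁ - (c₁ - c₂) := by ring
    rw [e]; exact (Valuation.map_sub _ _ _).trans (max_le hc₁.le hsep.le)
  set c₁O : 𝒪[K] := ⟨c₁, hc₁.le⟩ with hc₁O
  set c₂O : 𝒪[K] := ⟨c₂, hc₂⟩ with hc₂O
  have h12 : IsLocalRing.residue 𝒪[K] c₁O ≠ IsLocalRing.residue 𝒪[K] c₂O := by
    rw [Ne, ← sub_eq_zero, ← map_sub, residue_eq_zero_iff_v_lt_one, coe_sub_eq]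
    exact fun h => absurd hsep h.ne
  have hures : ∀ (cO : 𝒪[K]), Valued.v (σ (cO : K) * cO - 1) < 1 → σk (IsLocalRing.residue 𝒪[K] cO) * IsLocalRing.residue 𝒪[K] cO = 1 := by
    intro cO h
    have h' : IsLocalRing.residue 𝒪[K] (⟨σ (cO : K), hσO cO⟩ * cO - 1) = 0 := by
      rw [residue_eq_zero_iff_v_lt_one]; exact h
    rwa [map_sub, map_mul, hσk, map_one, sub_eq_zero] at h'
  -- the residual characteristic polynomial
  have hχb : ((kb : GL (Fin 3) 𝓀[K]) : Matrix (Fin 3) (Fin 3) 𝓀[K]).charpoly =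
      (X - C (IsLocalRing.residue 𝒪[K] c₁O)) ^ 2 * (X - C (IsLocalRing.residue 𝒪[K] c₂O)) := by
    have hO : ∀ i, Valued.v (((kO.charpoly - (X - C c₁O) ^ 2 * (X - C c₂O)).coeff i : 𝒪[K]) : K) < 1 := by
      intro i
      have h1 : (kO.charpoly - (X - C c₁O) ^ 2 * (X - C c₂O)).map 𝒪[K].subtype = kM.charpoly - (X - C c₁) ^ 2 * (X - C c₂) := by
        rw [Polynomial.map_sub, ← Matrix.charpoly_map, hkOK]
        simp only [Polynomial.map_mul, Polynomial.map_pow, Polynomial.map_sub, Polynomial.map_X, Polynomial.map_C]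
        rfl
      have h2 := Polynomial.coeff_map 𝒪[K].subtype (p := kO.charpoly - (X - C c₁O) ^ 2 * (X - C c₂O)) i
      rw [h1] at h2
      rw [← 𝒪[K].subtype_apply, ← h2]; exact hχ i
    have hz : (kO.charpoly - (X - C c₁O) ^ 2 * (X - C c₂O)).map (IsLocalRing.residue 𝒪[K]) = 0 := by
      ext i
      rw [Polynomial.coeff_map, coeff_zero, residue_eq_zero_iff_v_lt_one]; exact hO i
    rw [← hkOk, Matrix.charpoly_map]
    rw [Polynomial.map_sub, sub_eq_zero] at hz
    rw [hz]
    simp only [Polynomial.map_mul, Polynomial.map_pow, Polynomial.map_sub, Polynomial.map_X, Polynomial.map_C]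
  -- ★ T1 over the residue field
  obtain ⟨Pb, hA00, hA11, hA22, hAoff, hBp2, hBp1, hBimp⟩ := exists_eigenframe_of_charpoly_two_congruent hq σk hfrob kb hkbU h12
    (hures c₁O hu₁) (hures c₂O hu₂) hχb
  -- LIFT the residual frame entrywise: `PO`, its image `PM` in `K`, `|det PM| = 1`
  obtain ⟨lift, hlift⟩ : ∃ lift : 𝓀[K] → 𝒪[K], ∀ a, IsLocalRing.residue 𝒪[K] (lift a) = a :=
    ⟨Function.surjInv IsLocalRing.residue_surjective, Function.surjInv_eq IsLocalRing.residue_surjective⟩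
  set PO : Matrix (Fin 3) (Fin 3) 𝒪[K] := Matrix.of fun i j => lift ((Pb : Matrix (Fin 3) (Fin 3) 𝓀[K]) i j) with hPO
  have hPOk : PO.map (IsLocalRing.residue 𝒪[K]) = (Pb : Matrix (Fin 3) (Fin 3) 𝓀[K]) := by
    ext i j; rw [Matrix.map_apply, hPO, Matrix.of_apply, hlift]
  set PM : Matrix (Fin 3) (Fin 3) K := PO.map 𝒪[K].subtype with hPM
  have hPint : ∀ i j, Valued.v (PM i j) ≤ 1 := fun i j => (PO i j).2
  have hdetK : PM.det = ((PO.det : 𝒪[K]) : K) := by rw [hPM, ← RingHom.mapMatrix_apply, ← RingHom.map_det]; rfl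
  have hdetk : IsLocalRing.residue 𝒪[K] PO.det = (Pb : Matrix (Fin 3) (Fin 3) 𝓀[K]).det := by
    rw [RingHom.map_det, RingHom.mapMatrix_apply, hPOk]
  have hdetb : (Pb : Matrix (Fin 3) (Fin 3) 𝓀[K]).det ≠ 0 :=
    ((Matrix.isUnit_iff_isUnit_det _).1 (Units.isUnit Pb)).ne_zero
  have hdet1 : Valued.v PM.det = 1 := by
    rw [hdetK]
    refine le_antisymm (PO.det).2 (not_lt.1 fun hlt => hdetb ?_)
    rw [← hdetk, residue_eq_zero_iff_v_lt_one]; exact hlt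
  have hdet0 : PM.det ≠ 0 := fun h => by rw [h, map_zero] at hdet1; exact zero_ne_one hdet1
  set P : GL (Fin 3) K := Matrix.GeneralLinearGroup.mkOfDetNeZero PM hdet0 with hPdef
  have hPcoe : (P : Matrix (Fin 3) (Fin 3) K) = PM := rfl
  have hPglInt : P ∈ glInt 3 K :=
    mem_glInt_of_isIntegralMatrix (fun i j => (v_le_one_iff_mem_integer _).1 (hPint i j)) ((v_eq_one_iff_valuation_eq_one _).1 hdet1)
  have hP' : ∀ i j, Valued.v (((P⁻¹ : GL (Fin 3) K) : Matrix (Fin 3) (Fin 3) K) i j) ≤ 1 := ((mem_glInt_iff_forall_v_le_one P).1 hPglInt).2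
  -- the integral matrix `QO` of `P⁻¹`; its residue is `P̄⁻¹`
  set QO : Matrix (Fin 3) (Fin 3) 𝒪[K] := Matrix.of fun i j => (⟨((P⁻¹ : GL (Fin 3) K) : Matrix (Fin 3) (Fin 3) K) i j, hP' i j⟩ : 𝒪[K]) with hQO
  have hQOK : QO.map 𝒪[K].subtype = ((P⁻¹ : GL (Fin 3) K) : Matrix (Fin 3) (Fin 3) K) := by ext i j; rfl
  have hinj : Function.Injective (𝒪[K].subtype.mapMatrix : Matrix (Fin 3) (Fin 3) 𝒪[K] →+* Matrix (Fin 3) (Fin 3) K) :=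
    fun A B h => Matrix.ext fun i j => Subtype.ext (by have := congrArg (fun M : Matrix (Fin 3) (Fin 3) K => M i j) h; simpa using this)
  have hQOPO : QO * PO = 1 := hinj (by
    rw [map_mul, map_one, RingHom.mapMatrix_apply, RingHom.mapMatrix_apply, hQOK, ← hPM, ← hPcoe, Units.inv_mul])
  have hQbk : QO.map (IsLocalRing.residue 𝒪[K]) = ((Pb⁻¹ : GL (Fin 3) 𝓀[K]) : Matrix (Fin 3) (Fin 3) 𝓀[K]) := by
    have h1 : QO.map (IsLocalRing.residue 𝒪[K]) * (Pb : Matrix (Fin 3) (Fin 3) 𝓀[K]) = 1 := by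
      rw [← hPOk, ← RingHom.mapMatrix_apply, ← RingHom.mapMatrix_apply, ← map_mul, hQOPO, map_one]
    rw [Matrix.coe_units_inv, Matrix.inv_eq_left_inv h1]
  -- `A = P⁻¹kP` is the image of `AO = QO·kO·PO`, whose residue is `Ā = P̄⁻¹k̄P̄`
  set AO : Matrix (Fin 3) (Fin 3) 𝒪[K] := QO * kO * PO with hAO
  have hAOK : ∀ i j, ((AO i j : 𝒪[K]) : K) = (((P⁻¹ : GL (Fin 3) K) : Matrix (Fin 3) (Fin 3) K) * kM * (P : Matrix (Fin 3) (Fin 3) K)) i j := by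
    intro i j
    have h : 𝒪[K].subtype.mapMatrix AO = ((P⁻¹ : GL (Fin 3) K) : Matrix (Fin 3) (Fin 3) K) * kM * (P : Matrix (Fin 3) (Fin 3) K) := by
      rw [hAO, map_mul, map_mul, RingHom.mapMatrix_apply, RingHom.mapMatrix_apply, RingHom.mapMatrix_apply, hQOK, hkOK, ← hPM, hPcoe]
    exact congrArg (fun M : Matrix (Fin 3) (Fin 3) K => M i j) h
  have hAOk : ∀ i j, IsLocalRing.residue 𝒪[K] (AO i j) =
      ((((Pb⁻¹ : GL (Fin 3) 𝓀[K]) : Matrix (Fin 3) (Fin 3) 𝓀[K]) * (kb : Matrix (Fin 3) (Fin 3) 𝓀[K]) * (Pb : Matrix (Fin 3) (Fin 3) 𝓀[K])) i j) := by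
    intro i j
    have h : (IsLocalRing.residue 𝒪[K]).mapMatrix AO =
        ((Pb⁻¹ : GL (Fin 3) 𝓀[K]) : Matrix (Fin 3) (Fin 3) 𝓀[K]) * (kb : Matrix (Fin 3) (Fin 3) 𝓀[K]) * (Pb : Matrix (Fin 3) (Fin 3) 𝓀[K]) := by
      rw [hAO, map_mul, map_mul, RingHom.mapMatrix_apply, RingHom.mapMatrix_apply, RingHom.mapMatrix_apply, hQbk, hkOk, hPOk]
    exact congrArg (fun M : Matrix (Fin 3) (Fin 3) 𝓀[K] => M i j) h
  -- DICTIONARY: valuations of the entries of `A` ↔ residues; `B₀` of the columns ↔ residual `B₀`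
  have hAlt : ∀ (i j) (cO : 𝒪[K]), Valued.v ((((P⁻¹ : GL (Fin 3) K) : Matrix (Fin 3) (Fin 3) K) * kM * (P : Matrix (Fin 3) (Fin 3) K)) i j - (cO : K)) < 1 ↔
      ((((Pb⁻¹ : GL (Fin 3) 𝓀[K]) : Matrix (Fin 3) (Fin 3) 𝓀[K]) * (kb : Matrix (Fin 3) (Fin 3) 𝓀[K]) * (Pb : Matrix (Fin 3) (Fin 3) 𝓀[K])) i j) =
        IsLocalRing.residue 𝒪[K] cO := by
    intro i j cO
    rw [← hAOK, ← coe_sub_eq, ← residue_eq_zero_iff_v_lt_one, map_sub, sub_eq_zero, hAOk]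
  have hAlt0 : ∀ i j, Valued.v ((((P⁻¹ : GL (Fin 3) K) : Matrix (Fin 3) (Fin 3) K) * kM * (P : Matrix (Fin 3) (Fin 3) K)) i j) < 1 ↔
      ((((Pb⁻¹ : GL (Fin 3) 𝓀[K]) : Matrix (Fin 3) (Fin 3) 𝓀[K]) * (kb : Matrix (Fin 3) (Fin 3) 𝓀[K]) * (Pb : Matrix (Fin 3) (Fin 3) 𝓀[K])) i j) = 0 := by
    intro i j
    have h := hAlt i j 0
    rwa [ZeroMemClass.coe_zero, sub_zero, map_zero] at h
  have hcolO : ∀ j, PM *ᵥ (Pi.single j 1) = fun i => ((PO i j : 𝒪[K]) : K) := fun j => by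
    funext i; rw [Matrix.mulVec_single_one]; rfl
  have hcolk : ∀ j, (fun i => IsLocalRing.residue 𝒪[K] (PO i j)) = (Pb : Matrix (Fin 3) (Fin 3) 𝓀[K]) *ᵥ (Pi.single j 1) := fun j => by
    funext i; rw [Matrix.mulVec_single_one, ← hPOk]; rfl
  have hBlt : ∀ j j', Valued.v (B₀ σ 3 (PM *ᵥ Pi.single j 1) (PM *ᵥ Pi.single j' 1)) < 1 ↔
      B₀ σk 3 ((Pb : Matrix (Fin 3) (Fin 3) 𝓀[K]) *ᵥ Pi.single j 1) ((Pb : Matrix (Fin 3) (Fin 3) 𝓀[K]) *ᵥ Pi.single j' 1) = 0 := by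
    intro j j'
    rw [hcolO, hcolO, ← hcolk, ← hcolk, ← residue_B₀_eq hσO σk hσk, residue_eq_zero_iff_v_lt_one]
  have hB1 : ∀ j j', Valued.v (B₀ σ 3 (PM *ᵥ Pi.single j 1) (PM *ᵥ Pi.single j' 1)) = 1 ↔
      B₀ σk 3 ((Pb : Matrix (Fin 3) (Fin 3) 𝓀[K]) *ᵥ Pi.single j 1) ((Pb : Matrix (Fin 3) (Fin 3) 𝓀[K]) *ᵥ Pi.single j' 1) ≠ 0 := by
    intro j j'
    rw [Ne, ← hBlt j j']
    have hle : Valued.v (B₀ σ 3 (PM *ᵥ Pi.single j 1) (PM *ᵥ Pi.single j' 1)) ≤ 1 := by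
      rw [hcolO, hcolO]; exact B₀_coe_mem_integer hσO _ _
    exact ⟨fun h hlt => absurd h hlt.ne, fun h => le_antisymm hle (not_lt.1 h)⟩
  -- ASSEMBLE
  refine ⟨P, hPint, hP', (hAlt 0 0 c₁O).2 hA00, (hAlt 1 1 c₁O).2 hA11, (hAlt 2 2 c₂O).2 hA22,
    fun i j hij hne => (hAlt0 i j).2 (hAoff i j hij hne), (hB1 2 2).2 hBp2, (hBlt 1 1).2 hBp1, fun h10 => ?_⟩
  obtain ⟨h00b, h01b⟩ := hBimp ((hAlt0 1 0).1 h10)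
  exact ⟨(hBlt 0 0).2 h00b, (hB1 0 1).2 h01b⟩

-- the quotient-action instances `MulAction ↥K₀ (↥K₀ ⧸ I.subgroupOf K₀)` of ★ FILE 1 ∕ FILE 2 exceed the default synthesis budget (same bump as those ★ files)
set_option synthInstance.maxHeartbeats 400000 in
set_option maxHeartbeats 1600000 in
/-- **§2 R-II RUNG T — `a₁ = 1 + q·m` FROM THE INTRINSIC LETTERS.**  In ★ FILE 1's letters (`γ ∈ U`, section `r` of `U → U⧸K₀`, local monodromies
`k_x = r(x)⁻¹γr(x)`, finitely many fixed hyperspecial vertices, `|𝓀| = q²`, `σk = Frob_q`): if `χ_γ ≡ (X − c₁)²(X − c₂)` coefficientwise mod `𝔪` with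
`|c₁| = |c₁ − c₂| = 1` and `σ(cᵢ)cᵢ ≡ 1`, then the number `a₁` of `γ`-fixed special vertices is `1 + q·m`, `m` the number of fixed hyperspecial `x` with
`(k_x − c₁)(k_x − c₂) ≡ 0 (mod 𝔪)` — ★ rung 1′ `natCard_fixedBy_special_eq_one_add_mul_of_residually_two_congruent` with its frame hypothesis DISCHARGED at every `x` by
§1 (`χ_{k_x} = χ_γ`). [cite: Kottwitz1988, §2] [cite: Serre1980Trees, I.6] [cite: Tits1979, §3.5] [cite: Rogawski1990, §4.9] -/
theorem natCard_fixedBy_special_eq_one_add_mul_of_charpoly_two_congruent [ValuativeRel K] [(Valued.v : Valuation K ℤᵐ⁰).Compatible]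
    {σ : K →+* K} {ϖ : K} (hd : UnramifiedLocalConjDatum σ ϖ) (hσO : ∀ x : 𝒪[K], σ x ∈ 𝒪[K]) (σk : 𝓀[K] →+* 𝓀[K])
    (hσk : ∀ x : 𝒪[K], IsLocalRing.residue 𝒪[K] ⟨σ x, hσO x⟩ = σk (IsLocalRing.residue 𝒪[K] x))
    [Fintype 𝓀[K]] {q : ℕ} (hq : Fintype.card 𝓀[K] = q ^ 2) (hfrob : ∀ y, σk y = y ^ q)
    (g₁ : GL (Fin 3) K) (hg₁ : (g₁ : Matrix (Fin 3) (Fin 3) K) = Matrix.diagonal ![(1 : K), 1, ϖ])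
    (γ : ↥(unitaryGroupOfForm σ ((StdForm.antidiagonal 3).over K)))
    [Fintype (fixedBy (↥(unitaryGroupOfForm σ ((StdForm.antidiagonal 3).over K)) ⧸
      (glInt 3 K).subgroupOf (unitaryGroupOfForm σ ((StdForm.antidiagonal 3).over K))) γ)]
    (hK₁fin : (fixedBy (↥(unitaryGroupOfForm σ ((StdForm.antidiagonal 3).over K)) ⧸
      ((glInt 3 K).map (MulAut.conj g₁).toMonoidHom).subgroupOf (unitaryGroupOfForm σ ((StdForm.antidiagonal 3).over K))) γ).Finite)
    (horb : (Set.range fun n : ℕ => ((γ ^ n : ↥(unitaryGroupOfForm σ ((StdForm.antidiagonal 3).over K))) :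
      ↥(unitaryGroupOfForm σ ((StdForm.antidiagonal 3).over K)) ⧸ (glInt 3 K).subgroupOf (unitaryGroupOfForm σ ((StdForm.antidiagonal 3).over K)))).Finite)
    (r : ↥(unitaryGroupOfForm σ ((StdForm.antidiagonal 3).over K)) ⧸ (glInt 3 K).subgroupOf (unitaryGroupOfForm σ ((StdForm.antidiagonal 3).over K)) →
      ↥(unitaryGroupOfForm σ ((StdForm.antidiagonal 3).over K)))
    (hr : Function.RightInverse r QuotientGroup.mk)
    [∀ x : fixedBy (↥(unitaryGroupOfForm σ ((StdForm.antidiagonal 3).over K)) ⧸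
        (glInt 3 K).subgroupOf (unitaryGroupOfForm σ ((StdForm.antidiagonal 3).over K))) γ,
      Finite (fixedBy (↥((glInt 3 K).subgroupOf (unitaryGroupOfForm σ ((StdForm.antidiagonal 3).over K))) ⧸
        (((glInt 3 K).subgroupOf (unitaryGroupOfForm σ ((StdForm.antidiagonal 3).over K)) ⊓
          ((glInt 3 K).map (MulAut.conj g₁).toMonoidHom).subgroupOf (unitaryGroupOfForm σ ((StdForm.antidiagonal 3).over K))).subgroupOf
          ((glInt 3 K).subgroupOf (unitaryGroupOfForm σ ((StdForm.antidiagonal 3).over K)))))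
        (⟨(r x.1)⁻¹ * γ * r x.1, inv_mul_mul_mem_of_smul_eq r hr γ x.2⟩ :
          ↥((glInt 3 K).subgroupOf (unitaryGroupOfForm σ ((StdForm.antidiagonal 3).over K)))))]
    {c₁ c₂ : K} (hc₁ : Valued.v c₁ = 1) (hsep : Valued.v (c₁ - c₂) = 1) (hu₁ : Valued.v (σ c₁ * c₁ - 1) < 1) (hu₂ : Valued.v (σ c₂ * c₂ - 1) < 1)
    (hχ : ∀ i, Valued.v (((((γ : ↥(unitaryGroupOfForm σ ((StdForm.antidiagonal 3).over K))) : GL (Fin 3) K) : Matrix (Fin 3) (Fin 3) K).charpoly -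
      (X - C c₁) ^ 2 * (X - C c₂)).coeff i) < 1) :
    Nat.card (fixedBy (↥(unitaryGroupOfForm σ ((StdForm.antidiagonal 3).over K)) ⧸
        ((glInt 3 K).map (MulAut.conj g₁).toMonoidHom).subgroupOf (unitaryGroupOfForm σ ((StdForm.antidiagonal 3).over K))) γ) =
      1 + q * Nat.card {x : fixedBy (↥(unitaryGroupOfForm σ ((StdForm.antidiagonal 3).over K)) ⧸
            (glInt 3 K).subgroupOf (unitaryGroupOfForm σ ((StdForm.antidiagonal 3).over K))) γ //
          ∀ i j, Valued.v (((((((r x.1)⁻¹ * γ * r x.1 : ↥(unitaryGroupOfForm σ ((StdForm.antidiagonal 3).over K))) : GL (Fin 3) K) : Matrix (Fin 3) (Fin 3) K) -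
              c₁ • (1 : Matrix (Fin 3) (Fin 3) K)) *
            (((((r x.1)⁻¹ * γ * r x.1 : ↥(unitaryGroupOfForm σ ((StdForm.antidiagonal 3).over K))) : GL (Fin 3) K) : Matrix (Fin 3) (Fin 3) K) -
              c₂ • (1 : Matrix (Fin 3) (Fin 3) K))) i j) < 1} := by
  refine natCard_fixedBy_special_eq_one_add_mul_of_residually_two_congruent hd hσO σk hσk hq hfrob g₁ hg₁ γ hK₁fin horb r hr hc₁ hsep fun x => ?_
  have hkK₀ : ((r x.1)⁻¹ * γ * r x.1 : ↥(unitaryGroupOfForm σ ((StdForm.antidiagonal 3).over K))) ∈ unitaryInt σ ((StdForm.antidiagonal 3).over K) := by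
    rw [unitaryInt_eq_glInt_subgroupOf]
    exact inv_mul_mul_mem_of_smul_eq r hr γ x.2
  have hχk : ((((r x.1)⁻¹ * γ * r x.1 : ↥(unitaryGroupOfForm σ ((StdForm.antidiagonal 3).over K))) : GL (Fin 3) K) : Matrix (Fin 3) (Fin 3) K).charpoly =
      (((γ : ↥(unitaryGroupOfForm σ ((StdForm.antidiagonal 3).over K))) : GL (Fin 3) K) : Matrix (Fin 3) (Fin 3) K).charpoly := by
    rw [Subgroup.coe_mul, Subgroup.coe_mul, Subgroup.coe_inv, Units.val_mul, Units.val_mul, Matrix.coe_units_inv]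
    exact Matrix.charpoly_units_conj' _ _
  exact exists_frame_of_charpoly_two_congruent hσO σk hσk hq hfrob _ hkK₀ hc₁ hsep hu₁ hu₂ fun i => by rw [hχk]; exact hχ i

end Summit.HodgeConjecture.HodgeConjecture.R90.S6

end
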